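import Summits.Ventures.DiscreteObjects.UnitDistance.QuadraticPlanesFourE
import Summits.Ventures.DiscreteObjects.UnitDistance.PlaneSqrt311Bounds
import Summits.Ventures.DiscreteObjects.UnitDistance.PlaneSqrt335Bounds
import Summits.Ventures.DiscreteObjects.UnitDistance.PlaneSqrt359Four
import HarnessLib

/-!
# Quadratic planes with chromatic number four, VI: `d = 359` (`= 4`), `d = 335` (`∈ {4, 5}`) and the table of `d ≡ 3 (mod 4)` between `200` and `400`
(cell `pub-namedobj`, target (U), seat udg g15 — summary)

Framing (verbatim for the cell): lottery ticket; floor = certified bounds/negative ranges.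

Two new rows beyond `200`, both found by udg g15's odd-cycle census of the open `d ≡ 11 (mod 12)` (pentagon / heptagon families of ALL Gaussian classes,
then one radius-4 ball of the flagged family): `χ(ℚ(√359)²) = 4` (`PlaneSqrt359Four.lean`: `W₃₅₉` on `973` vertices from the family `{1, 5, 60}` — the shape
of the 76-vertex `W₁₉₁` —, a 1,156-step kernel RUP certificate in five pieces, upper bound the 7-adic criterion) and `4 ≤ χ(ℚ(√335)²) ≤ 5`
(`PlaneSqrt335Bounds.lean`: `W₃₃₅` on `480` vertices from `{1, 5, 36, 60, 180}`, 354 steps in two pieces, upper bound the 11-adic criterion; no 4-colouring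
criterion of the tree applies to `335 ≡ 7 (mod 8)`).  CONSEQUENCE (`quadratic_table_three_mod_four_200_400`): for the forty square-free `d ≡ 3 (mod 4)` with
`200 < d < 400` the tree has `χ(ℚ(√d)²) = 3` for the twenty-four `d ≢ 2 (mod 3)`, `= 4` for `d = 359`, `∈ {4, 5}` for `d = 311, 335`, `∈ {3, 4}` (not
`2`-colourable, `4`-colourable) for the eight `d ≡ 3 (mod 8)` among the rest (`203, 227, 251, 299, 323, 347, 371, 395`) and for `239, 263` (7-adic), and only
`χ ≥ 3` for `215, 287, 383` (`≡ 7 (mod 8)`, non-residues mod `7`; `≤ 5` by the 11- and 19-adic criteria is not restated here).  udg g14's computation `χ(ℚ(√239)²) = 4`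
(core ≈ 1,800 vertices) is not in the kernel.  Values `≥ 4` not found in print (PROVISIONAL).
-/

noncomputable section

namespace Summit.Ventures.DiscreteObjects.UnitDistance

open SimpleGraph IntermediateField
open scoped IntermediateField

/-- TWO NEW ROWS: `χ(ℚ(√359)²) = 4` and `4 ≤ χ(ℚ(√335)²) ≤ 5`. -/
theorem chromaticNumber_plane_sqrt_359_335 :
    (planeUnitDistanceGraph.induce (fieldPoints ℚ⟮Real.sqrt 359⟯)).chromaticNumber = 4 ∧
    (4 ≤ (planeUnitDistanceGraph.induce (fieldPoints ℚ⟮Real.sqrt 335⟯)).chromaticNumber ∧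
      (planeUnitDistanceGraph.induce (fieldPoints ℚ⟮Real.sqrt 335⟯)).chromaticNumber ≤ 5) :=
  ⟨chromaticNumber_plane_sqrt359, chromaticNumber_plane_sqrt335_bounds⟩

/-- THE QUADRATIC TABLE FOR SQUARE-FREE `d ≡ 3 (mod 4)`, `200 < d < 400` (forty values): `= 3` for the twenty-four `d ≢ 2 (mod 3)`; `= 4` for `359`;
`∈ {4, 5}` for `311, 335`; not `2`-colourable and `4`-colourable for `203, 227, 251, 299, 323, 347, 371, 395` (2-adic) and `239, 263` (7-adic); not
`2`-colourable for `215, 287, 383`. -/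
theorem quadratic_table_three_mod_four_200_400 :
    (∀ d ∈ ({211, 219, 223, 231, 235, 247, 255, 259, 267, 271, 283, 291, 295, 303, 307, 319, 327, 331, 339, 355, 367, 379, 391, 399} : Finset ℕ),
        (planeUnitDistanceGraph.induce (fieldPoints (multiSqrtField {d}))).chromaticNumber = 3) ∧
    (planeUnitDistanceGraph.induce (fieldPoints (multiSqrtField {359}))).chromaticNumber = 4 ∧
    (∀ d ∈ ({311, 335} : Finset ℕ),
        4 ≤ (planeUnitDistanceGraph.induce (fieldPoints (multiSqrtField {d}))).chromaticNumber ∧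
          (planeUnitDistanceGraph.induce (fieldPoints (multiSqrtField {d}))).chromaticNumber ≤ 5) ∧
    (∀ d ∈ ({203, 227, 251, 299, 323, 347, 371, 395} : Finset ℕ),
        ¬ (planeUnitDistanceGraph.induce (fieldPoints ℚ⟮Real.sqrt d⟯)).Colorable 2 ∧
          (planeUnitDistanceGraph.induce (fieldPoints ℚ⟮Real.sqrt d⟯)).Colorable 4) ∧
    (∀ d ∈ ({239, 263} : Finset ℕ),
        ¬ (planeUnitDistanceGraph.induce (fieldPoints (multiSqrtField {d}))).Colorable 2 ∧
          (planeUnitDistanceGraph.induce (fieldPoints (multiSqrtField {d}))).Colorable 4) ∧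
    (∀ d ∈ ({215, 287, 383} : Finset ℕ), ¬ (planeUnitDistanceGraph.induce (fieldPoints ℚ⟮Real.sqrt d⟯)).Colorable 2) := by
  refine ⟨?_, chromaticNumber_plane_multiSqrtField_359, ?_, ?_, ?_, ?_⟩
  · intro d hd
    simp only [Finset.mem_insert, Finset.mem_singleton] at hd
    rcases hd with rfl | rfl | rfl | rfl | rfl | rfl | rfl | rfl | rfl | rfl | rfl | rfl | rfl | rfl | rfl | rfl | rfl | rfl | rfl | rfl |
        rfl | rfl | rfl | rfl <;>
      exact chromaticNumber_plane_eq_three_of_mem_mod_four _ (by decide) (Finset.mem_singleton_self _) (by norm_num)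
  · intro d hd
    simp only [Finset.mem_insert, Finset.mem_singleton] at hd
    rcases hd with rfl | rfl
    · exact chromaticNumber_plane_multiSqrtField_311_bounds
    · exact chromaticNumber_plane_multiSqrtField_335_bounds
  · intro d hd
    simp only [Finset.mem_insert, Finset.mem_singleton] at hd
    rcases hd with rfl | rfl | rfl | rfl | rfl | rfl | rfl | rfl <;> exact plane_sqrt_three_four_of_mod_eight _ (by norm_num)
  · intro d hd
    simp only [Finset.mem_insert, Finset.mem_singleton] at hd
    rcases hd with rfl | rfl <;>
      exact ⟨not_colorable_two_plane_multiSqrtField (Finset.mem_singleton_self _) (by norm_num),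
        colorable_four_plane_of_sevenAdic _ (by decide)⟩
  · intro d hd
    simp only [Finset.mem_insert, Finset.mem_singleton] at hd
    rcases hd with rfl | rfl | rfl <;> exact not_colorable_two_plane_sqrt _ (by norm_num)

end Summit.Ventures.DiscreteObjects.UnitDistance
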